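import Summits.ResolutionOfSingularities.ResolutionOfSingularities.Theorems.FrobeniusClosingSteerBetaCleaningTransferX
import Summits.ResolutionOfSingularities.ResolutionOfSingularities.Theorems.FrobeniusClosingSteerBetaFaceMoves
import Summits.ResolutionOfSingularities.ResolutionOfSingularities.Theorems.FrobeniusClosingSteerBetaVertexMoves
import Summits.ResolutionOfSingularities.ResolutionOfSingularities.Theorems.FrobeniusClosingSteerBetaPreparedTransferY
import HarnessLib

/-!
# Crux `Steer` (stmt-ResolutionOfSingularities-16345), chain W4.1, β-LEAF, K-β2♭ part (II), file 12: the PREPAREDNESS TRANSFER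
# along the `x`-chart letter at the origin — res-L0-w41-idea-1's `PreparedTransferXHat` (C′, `c = 0`) with the SQUARE-FREE
# twist repair (def-free)

OURS (campaign `res-hironaka`, rung L ★L-G4, slot W4.1; statements about the route's own objects; they replace the
role of no printed item and are NOT statements of the manuscript under review [claim: Hironaka2017, status:
under-review]; AI review is weaker than expert review). Seat res-D-pv-003 (gen 7), K-β2♭ kernel owner (res-L0-w41-plan-1
RULINGS 143/150 (2)/181b/185d).

**`preparedTransferX`** — CJS Lemma 12.1 (4) modulo `u`-squares at the ORIGIN of the `x`-chart, in the binder shape of the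
β-leaf of record v18.4-J4 (`Sketch-idea-1-v18-hatleaf.v184-J4.lean` 28dc800f580739ec, `PreparedTransferXHat`) with the R-J4a
square-free twist clause (here only the `x`-exponent `a ≤ 1` is used; res-L0-w41-tri-2 v26 (R-J4.2) has the `u = x³y²` instance
without it): along `φ y = φ x · v₁`, `φ z = φ x · z₁`, `φ w = φ x · w₁` between arithmetic stages, a representative with
`AlphaGe α₀` that is PREPARED AT THE LOWER END `w⁻ = (δ − γ, γ)` OF ITS `δ`-FACE modulo `u`-squares (`DeltaGe δ`, `DeltaFaceGe δ γ`,
no cleaning and no integral face move + cleaning reaches `DeltaFaceGt δ γ`) transforms to one PREPARED AT ITS LEFT VERTEX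
`(δ − 1, γ)` modulo `u₁`-squares, with `γ ≤ δ − α₀` and `d!·γ ∈ ℕ`. The conclusion's middle conjunct is literally the body of
`IsPreparedTwAt u₁ (φ x) v₁ z₁ w₁ d (δ − 1) γ f₁`. Completeness is not used; `Odd d`/`3 ≤ d` only as `0 < d`.

[cite: CossartJannsenSaito2020, Lemma 12.1] [cite: CossartPiltant2019, Prop. 2.1 and 2.6] No Theses file is imported; nothing
here is a route item or a registration.
-/

noncomputable section

-- `Summit.<S>.<S>.…` duplicates the summit name by design (single-problem summit).
set_option linter.dupNamespace false

namespace Summit.ResolutionOfSingularities.ResolutionOfSingularities.Theorems.SwitchingDichotomy.BetaNewton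

open IsLocalRing nonZeroDivisors
open Literature.AlgebraicGeometry.Resolution
open Literature.AlgebraicGeometry.Resolution.CossartPiltant (uPow minExponents)
open Summit.ResolutionOfSingularities.ResolutionOfSingularities.Theorems.SwitchingDichotomy.BetaPolygon
open Summit.ResolutionOfSingularities.ResolutionOfSingularities.Theorems.SwitchingDichotomy.BetaLetter (xLetterPush)

variable {S S₁ : Type} [CommRing S] [CommRing S₁]

/-! ## §1 Bookkeeping -/

/-- At the origin of the `x`-chart (`c = 0`) the residue-field clause of `IsXChartHat` says `κ → κ₁` is onto. [folklore] -/
theorem surjective_of_xChart_zero [IsLocalRing S] [IsLocalRing S₁] (φ : S →+* S₁) (σ : ResidueField S →+* S)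
    (h : ∀ b : ResidueField S₁, ∃ P : Polynomial (ResidueField S),
      b = P.eval₂ ((residue S₁).comp (φ.comp σ)) 0) :
    Function.Surjective ((residue S₁).comp (φ.comp σ)) := by
  intro b
  obtain ⟨P, hP⟩ := h b
  exact ⟨P.coeff 0, by rw [hP, Polynomial.eval₂_at_zero]⟩

/-- **`δ ≥ 1` at a face-prepared datum**: if `f ∈ 𝔪^d` and `δ < 1`, then the face end is strictly exceeded (`DeltaFaceGt δ γ f`),
for every `γ`. [folklore] -/
theorem deltaFaceGt_of_lt_one [IsLocalRing S] {x y z w : S} (ht : IsRsopPart ![x, y, z, w])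
    (hspan : Ideal.span {x, y, z, w} = maximalIdeal S) {d : ℕ} {f : S} (hfd : f ∈ maximalIdeal S ^ d) {δ : ℚ}
    (hδ : δ < 1) (γ : ℚ) : DeltaFaceGt x y z w d δ γ f := by
  refine deltaFaceGt_of_forall_minExponents ht δ γ fun c hc => ?_
  by_cases hzw : d ≤ c 2 + c 3
  · exact Or.inl hzw
  · right; left
    have hdeg : d ≤ c 0 + c 1 + c 2 + c 3 := by
      rw [← sum_four]; exact (mem_pow_iff_forall_minExponents ht hspan d f).mp hfd c hc
    set n : ℕ := d - c 2 - c 3 with hn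
    have hn1 : n ≤ c 0 + c 1 := by omega
    have hlt : ⌊δ * (n : ℚ)⌋₊ < n := by
      by_cases h0 : 0 ≤ δ * (n : ℚ)
      · refine (Nat.floor_lt h0).mpr ?_
        have : (0 : ℚ) < n := by exact_mod_cast (show 0 < n by omega)
        nlinarith
      · push Not at h0
        rw [Nat.floor_of_nonpos h0.le]
        omega
    omega

/-! ## §2 The preparedness transfer along the `x`-chart letter -/

/-- **PREPAREDNESS TRANSFER along the `x`-chart letter at the origin** (res-L0-w41-idea-1's `PreparedTransferXHat` C′ (`c = 0`),
β-leaf of record v18.4-J4, square-free twist; CJS Lemma 12.1 (4) modulo `u`-squares): face-prepared at `w⁻ = (δ − γ, γ)` upstairs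
⇒ `γ ≤ δ − α₀`, prepared at the left vertex `(δ − 1, γ)` downstairs, and `d!·γ ∈ ℕ`. [cite: CossartJannsenSaito2020, Lemma 12.1]
[cite: CossartPiltant2019, Prop. 2.6] -/
theorem preparedTransferX [IsLocalRing S] [CharP S 2] [IsLocalRing S₁] [CharP S₁ 2]
    (hreg : IsRegularLocalRing S) (hdim : ringKrullDim S = 4) (hperf : PerfectField (ResidueField S))
    (hreg₁ : IsRegularLocalRing S₁) (hdim₁ : ringKrullDim S₁ = 4)
    (φ : S →+* S₁) (σ : ResidueField S →+* S) (hsurj : Function.Surjective ((residue S₁).comp (φ.comp σ)))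
    {x y z w u f : S} {v₁ z₁ w₁ u₁ f₁ : S₁} {d k a b a₁ b₁ : ℕ} (hd : 0 < d)
    (hspan : Ideal.span {x, y, z, w} = maximalIdeal S) (hu : u = x ^ a * y ^ b) (hasq : a ≤ 1)
    (hcone : ∃ Ψ : MvPolynomial (Fin 2) S, Ψ.IsHomogeneous d ∧
      (∀ a b : ResidueField S, (a ≠ 0 ∨ b ≠ 0) → MvPolynomial.eval ![a, b] (MvPolynomial.map (residue S) Ψ) ≠ 0) ∧
      f - MvPolynomial.eval ![z, w] Ψ ∈ Ideal.span {x, y} * maximalIdeal S ^ (d - 1) ⊔ maximalIdeal S ^ (d + 1))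
    (hspan₁ : Ideal.span {φ x, v₁, z₁, w₁} = maximalIdeal S₁) (hu₁ : u₁ = φ x ^ a₁ * v₁ ^ b₁)
    (hcone₁ : ∃ Ψ : MvPolynomial (Fin 2) S₁, Ψ.IsHomogeneous d ∧
      (∀ a b : ResidueField S₁, (a ≠ 0 ∨ b ≠ 0) → MvPolynomial.eval ![a, b] (MvPolynomial.map (residue S₁) Ψ) ≠ 0) ∧
      f₁ - MvPolynomial.eval ![z₁, w₁] Ψ ∈ Ideal.span {φ x, v₁} * maximalIdeal S₁ ^ (d - 1) ⊔ maximalIdeal S₁ ^ (d + 1))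
    (hy : φ y = φ x * v₁) (hz : φ z = φ x * z₁) (hw : φ w = φ x * w₁)
    (hrad : φ (u * f) = φ x ^ (2 * k) * (u₁ * f₁))
    {α₀ δ γ : ℚ} (hAl : AlphaGe x z w d α₀ f) (hγ : 0 ≤ γ) (hDG : DeltaGe x y z w d δ f)
    (hFG : DeltaFaceGe x y z w d δ γ f)
    (hncl : ∀ q : S, ¬ DeltaFaceGt x y z w d δ γ (f + u * q ^ 2))
    (hnmv : ∀ a b : ℕ, (δ = a + b ∧ γ = b) → ∀ c₁ c₂ q : S,
      ¬ DeltaFaceGt x y (z + c₁ * x ^ a * y ^ b) (w + c₂ * x ^ a * y ^ b) d δ γ (f + u * q ^ 2)) :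
    γ ≤ δ - α₀ ∧
    (0 ≤ δ - 1 ∧ 0 ≤ γ ∧ AlphaGe (φ x) z₁ w₁ d (δ - 1) f₁ ∧ BetaGe (φ x) v₁ z₁ w₁ d (δ - 1) γ f₁ ∧
      ¬ BetaGt (φ x) v₁ z₁ w₁ d (δ - 1) γ f₁ ∧
      ¬ ((∃ q : S₁, BetaGt (φ x) v₁ z₁ w₁ d (δ - 1) γ (f₁ + u₁ * q ^ 2)) ∨
        ∃ a b : ℕ, (δ - 1 = a ∧ γ = b) ∧ ∃ c₁ c₂ q : S₁,
          BetaGt (φ x) v₁ (z₁ + c₁ * φ x ^ a * v₁ ^ b) (w₁ + c₂ * φ x ^ a * v₁ ^ b) d (δ - 1) γ (f₁ + u₁ * q ^ 2))) ∧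
    ∃ n : ℕ, (d.factorial : ℚ) * γ = n := by
  classical
  haveI := hreg
  haveI := hreg₁
  haveI : IsDomain S₁ := isDomain_of_isRegularLocalRing S₁
  have ht : IsRsopPart ![x, y, z, w] := isRsopPart_four hreg hdim hspan
  have ht' : IsRsopPart ![φ x, v₁, z₁, w₁] := isRsopPart_four hreg₁ hdim₁ hspan₁
  -- cone data
  obtain ⟨Ψ, hΨ, hroot, hfΨ⟩ := hcone
  obtain ⟨Ψ₁, hΨ₁, hroot₁, hfΨ₁⟩ := hcone₁
  have hΨd := coeff_single_notMem_of_rootless hΨ (hroot 1 0 (Or.inl one_ne_zero))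
  have hΨ₁d := coeff_single_notMem_of_rootless hΨ₁ (hroot₁ 1 0 (Or.inl one_ne_zero))
  have hfd : f ∈ maximalIdeal S ^ d := mem_pow_of_cone hspan hd hΨ hfΨ
  have hf₁d : f₁ ∈ maximalIdeal S₁ ^ d := mem_pow_of_cone hspan₁ hd hΨ₁ hfΨ₁
  have hcf := single_two_mem_minExponents_of_cone ht hspan hΨ hΨd hfΨ
  have hcf₁ := single_two_mem_minExponents_of_cone ht' hspan₁ hΨ₁ hΨ₁d hfΨ₁
  -- `δ ≥ 1`
  have hnI : ¬ DeltaFaceGt x y z w d δ γ f := by simpa using hncl 0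
  have hδ : 1 ≤ δ := by
    by_contra hlt
    push Not at hlt
    exact hnI (deltaFaceGt_of_lt_one ht hspan hfd hlt γ)
  -- strict transform and its identification with `f₁`
  obtain ⟨g, hg⟩ := exists_strictTransformX φ hy hz hw (d := d) (f := f) (by rw [hspan]; exact hfd)
  have hgf : g * φ x ^ d = φ f := by rw [hg, mul_comm]
  obtain ⟨-, h2⟩ := minExponents_strictTransformX φ ht ht' hspan hspan₁ hy hz hw hfd hgf
  obtain ⟨ag, hag, hagle⟩ := h2 _ hcf
  obtain ⟨k0, k1, -, -⟩ := (le_transportX_iff _ ag d).mp hagle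
  have hag0 : ag 0 = 0 := by simpa using k0
  have hag1 : ag 1 = 0 := by simpa using k1
  obtain ⟨hgf₁, hb₁, hk⟩ := strictTransform_eq_of_radicand_X φ ht' hy hu hu₁ hg hrad hag hag0 hag1 hcf₁ (by simp) (by simp)
  have hf' : φ f = φ x ^ d * f₁ := by rw [hg, hgf₁]
  have hf : f₁ * φ x ^ d = φ f := by rw [hf', mul_comm]
  -- positive thresholds by the push-forward law (I-X)
  have hx0 : φ x ∈ S₁⁰ := mem_nonZeroDivisors_of_ne_zero (by simpa using ht'.ne_zero 0)
  obtain ⟨hAl₁, hBe₁⟩ := xLetterPush φ hx0 hy hz hw hf'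
  -- the face vertex
  have hGs := forall_minExponents_of_deltaFaceGe ht (by linarith) hγ hFG
  have hex : ∃ c ∈ minExponents ![x, y, z, w] f,
      ¬ (d ≤ c 2 + c 3 ∨ ⌊δ * ((d - c 2 - c 3 : ℕ) : ℚ)⌋₊ + 1 ≤ c 0 + c 1 ∨
        (⌈δ * ((d - c 2 - c 3 : ℕ) : ℚ)⌉₊ ≤ c 0 + c 1 ∧ ⌊γ * ((d - c 2 - c 3 : ℕ) : ℚ)⌋₊ + 1 ≤ c 1)) := by
    by_contra hne
    push Not at hne
    exact hnI (deltaFaceGt_of_forall_minExponents ht δ γ hne)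
  obtain ⟨av, hav, hPav⟩ := hex
  obtain ⟨hzwv, hav01, hav1⟩ := exponent_eq_of_faceGe_of_not_faceGt (by linarith) hγ (hGs av hav) hPav
  have hγδ : γ ≤ δ := by
    set m : ℕ := d - av 2 - av 3 with hm
    have hm0 : (0 : ℚ) < m := by exact_mod_cast (show 0 < m by omega)
    push_cast at hav01
    have : γ * (m : ℚ) ≤ δ * m := by rw [← hav1, ← hav01]; exact_mod_cast Nat.le_add_left (av 1) (av 0)
    exact le_of_mul_le_mul_right this hm0
  obtain ⟨-, htwo⟩ := transport_faceVertex_mem_minExponents φ ht ht' hspan hspan₁ hy hz hw hfd hf hf₁d hδ hγ hFG hav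
    hzwv hav01 hav1
  have hk' : 2 * k + a₁ = a + b + d := hk
  refine ⟨?_, ⟨by linarith, hγ, hAl₁ δ hδ hDG, hBe₁ δ γ hδ hγ hFG, ?_, ?_⟩, factorial_mul_faceOrdinate hzwv hav1⟩
  · -- `γ ≤ δ − α₀`
    by_cases hα0 : 0 ≤ α₀
    · exact le_sub_of_alphaGe_faceVertex hzwv hav01 hav1 ((alphaGe_iff_forall_minExponents ht hα0 f).mp hAl av hav)
    · push Not at hα0; linarith
  · -- not strictly beyond the vertex downstairs
    intro hgt
    obtain ⟨q, hq⟩ := cleaning_transferX hperf φ ht ht' hspan hspan₁ hy hz hw hfd hf hf₁d hδ hγ hFG hasq hk'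
      ⟨0, by simpa using hgt⟩
    exact hncl q (by rw [hu]; exact hq)
  · rintro (⟨q₁, hq₁⟩ | ⟨a', b', ⟨hδa, hγb⟩, c₁, c₂, q₁, hq₁⟩)
    · rw [hu₁, hb₁] at hq₁
      obtain ⟨q, hq⟩ := cleaning_transferX hperf φ ht ht' hspan hspan₁ hy hz hw hfd hf hf₁d hδ hγ hFG hasq hk' ⟨q₁, hq₁⟩
      exact hncl q (by rw [hu]; exact hq)
    · -- an integral move + cleaning downstairs: lift the constants through `κ = κ₁`, move the frames, lift the cleaning
      have hle : b' ≤ a' + 1 := by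
        have : (b' : ℚ) ≤ a' + 1 := by linarith
        exact_mod_cast this
      set aδ : ℕ := a' + 1 - b' with haδ
      have hδ' : δ = (aδ : ℚ) + b' := by rw [haδ, Nat.cast_sub hle]; push_cast; linarith
      have hab' : 1 ≤ a' + b' := by
        have : (1 : ℚ) ≤ a' + b' := by linarith
        exact_mod_cast this
      have habδ : aδ + b' = a' + 1 := by omega
      -- lift the move constants
      obtain ⟨r₁, hr₁⟩ := hsurj (residue S₁ c₁)
      obtain ⟨r₂, hr₂⟩ := hsurj (residue S₁ c₂)
      simp only [RingHom.comp_apply] at hr₁ hr₂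
      have hε₁ : c₁ - φ (σ r₁) ∈ maximalIdeal S₁ := (Ideal.Quotient.mk_eq_mk_iff_sub_mem _ _).mp hr₁.symm
      have hε₂ : c₂ - φ (σ r₂) ∈ maximalIdeal S₁ := (Ideal.Quotient.mk_eq_mk_iff_sub_mem _ _).mp hr₂.symm
      -- the moved frames
      set zu : S := z + σ r₁ * x ^ aδ * y ^ b' with hzu
      set wu : S := w + σ r₂ * x ^ aδ * y ^ b' with hwu
      set zd : S₁ := z₁ + φ (σ r₁) * (φ x ^ a' * v₁ ^ b') with hzd
      set wd : S₁ := w₁ + φ (σ r₂) * (φ x ^ a' * v₁ ^ b') with hwd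
      have hMu : x ^ aδ * y ^ b' ∈ Ideal.span ({x, y} : Set S) := by
        rcases Nat.eq_zero_or_pos aδ with ha | ha
        · obtain ⟨e, he⟩ : ∃ e, b' = e + 1 := ⟨b' - 1, by omega⟩
          rw [ha, he, pow_zero, one_mul, pow_succ]
          exact Ideal.mul_mem_left _ _ (Ideal.subset_span (by simp))
        · obtain ⟨e, he⟩ : ∃ e, aδ = e + 1 := ⟨aδ - 1, by omega⟩
          rw [he, pow_succ, mul_assoc, mul_comm x, ← mul_assoc]
          exact Ideal.mul_mem_left _ _ (Ideal.subset_span (by simp))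
      have hMd : φ x ^ a' * v₁ ^ b' ∈ Ideal.span ({φ x, v₁} : Set S₁) := by
        rcases Nat.eq_zero_or_pos a' with ha | ha
        · obtain ⟨e, he⟩ : ∃ e, b' = e + 1 := ⟨b' - 1, by omega⟩
          rw [ha, he, pow_zero, one_mul, pow_succ]
          exact Ideal.mul_mem_left _ _ (Ideal.subset_span (by simp))
        · obtain ⟨e, he⟩ : ∃ e, a' = e + 1 := ⟨a' - 1, by omega⟩
          rw [he, pow_succ, mul_assoc, mul_comm (φ x), ← mul_assoc]
          exact Ideal.mul_mem_left _ _ (Ideal.subset_span (by simp))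
      have hspanu : Ideal.span {x, y, zu, wu} = maximalIdeal S := by
        rw [hzu, hwu, mul_assoc, mul_assoc,
          span_four_move_eq x y z w (Ideal.mul_mem_left _ _ hMu) (Ideal.mul_mem_left _ _ hMu), hspan]
      have hspand : Ideal.span {φ x, v₁, zd, wd} = maximalIdeal S₁ := by
        rw [hzd, hwd, span_four_move_eq (φ x) v₁ z₁ w₁ (Ideal.mul_mem_left _ _ hMd) (Ideal.mul_mem_left _ _ hMd), hspan₁]
      have htu : IsRsopPart ![x, y, zu, wu] := isRsopPart_four hreg hdim hspanu
      have htd : IsRsopPart ![φ x, v₁, zd, wd] := isRsopPart_four hreg₁ hdim₁ hspand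
      have hpow : φ x ^ aδ * φ x ^ b' = φ x * φ x ^ a' := by rw [← pow_add, habδ, pow_succ']
      have hzud : φ zu = φ x * zd := by
        calc φ zu = φ x * z₁ + φ (σ r₁) * v₁ ^ b' * (φ x ^ aδ * φ x ^ b') := by
              rw [hzu, map_add, map_mul, map_mul, map_pow, map_pow, hy, hz]; ring
          _ = φ x * zd := by rw [hpow, hzd]; ring
      have hwud : φ wu = φ x * wd := by
        calc φ wu = φ x * w₁ + φ (σ r₂) * v₁ ^ b' * (φ x ^ aδ * φ x ^ b') := by
              rw [hwu, map_add, map_mul, map_mul, map_pow, map_pow, hy, hw]; ring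
          _ = φ x * wd := by rw [hpow, hwd]; ring
      -- `DeltaFaceGe` in the moved frame upstairs
      have hFGu : DeltaFaceGe x y zu wu d δ γ f := by
        rw [hδ', hγb]
        rw [hδ', hγb] at hFG
        exact (deltaFaceGe_faceMove_iff x y z w aδ b' (σ r₁) (σ r₂) d f).mpr hFG
      -- the downstairs hypothesis in the frame `(zd, wd)`
      have hq₁' : BetaGt (φ x) v₁ zd wd d (δ - 1) γ (f₁ + φ x ^ a₁ * v₁ ^ b * q₁ ^ 2) := by
        rw [hu₁, hb₁, hδa, hγb] at hq₁
        rw [hδa, hγb]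
        have e1 : z₁ + c₁ * φ x ^ a' * v₁ ^ b' = zd + (c₁ - φ (σ r₁)) * (φ x ^ a' * v₁ ^ b') := by rw [hzd]; ring
        have e2 : w₁ + c₂ * φ x ^ a' * v₁ ^ b' = wd + (c₂ - φ (σ r₂)) * (φ x ^ a' * v₁ ^ b') := by rw [hwd]; ring
        rw [e1, e2] at hq₁
        exact (betaGt_move_maximalIdeal_iff hspand a' b' hab' hε₁ hε₂ d _).mp hq₁
      obtain ⟨q, hq⟩ := cleaning_transferX hperf φ htu htd hspanu hspand hy hzud hwud hfd hf hf₁d hδ hγ hFGu hasq hk'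
        ⟨q₁, hq₁'⟩
      refine hnmv aδ b' ⟨hδ', hγb⟩ (σ r₁) (σ r₂) q ?_
      rw [hu]
      exact hq

end Summit.ResolutionOfSingularities.ResolutionOfSingularities.Theorems.SwitchingDichotomy.BetaNewton

end
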